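import Summits.Parity.GeneralizedHardyLittlewood.Theorems.ConstellationCubesFibreTranslation
import Summits.Parity.GeneralizedHardyLittlewood.Theses.ConstellationCubes
import Summits.Parity.GeneralizedHardyLittlewood.Theses.TwinMinorArcs
import Summits.Parity.GeneralizedHardyLittlewood.Theorems.LeeYangFibresFibrationLemmaFinal
import Literature.NumberTheory.Sieve.LinearEquationsInPrimesPseudorandom
import HarnessLib

/-!
# `OneClassHL` from `BoundedDickson`: the fibration lemma for same-support cube systems

Route `ConstellationCubes` (node RelativeCubes, child 1 of the split `CubeHL ⟺ OneClassHL ∧ RelCube`).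
`OneClassHL` (item stmt-Parity-30019) is the two-sided fixed-pattern Hardy–Littlewood asymptotic for
CUBE systems all of whose forms have the SAME support: `ψᵢ(n) = aᵢ σ·n + bᵢ` with one `0/1`-vector `σ`
(`σ₀ = 1`). `BoundedDickson` (route `TwinMinorArcs`, item stmt-Parity-13151) is its `d = 1` face. Here:

* `oneClassHL_of_boundedDickson : BoundedDickson → OneClassHL` (§3–§5, the fibration lemma);
* `boundedDickson_of_oneClassHL`, `oneClassHL_iff_boundedDickson : OneClassHL ↔ BoundedDickson` (§6, the
  easy converse): the child `OneClassHL` is BY NAME equivalent to the tree item `BoundedDickson` (decomp-parity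
  critic precision P1, CRITIC-LEDGER row 52); with `ConstellationCubesCubeHLGlue.node_iff` the split reads
  `CubeHL ⟺ BoundedDickson ∧ RelCube`.

## Proof (Green–Tao's fibration remark for a FIXED system)

* §3 *LEFT half, fixed* (`fibreSums_fixed`): fibre `∑_K Λ^{⊗t}(Ψ)` over the base points
  (`vonMangoldtSum_eq_sum_fibre`); all fibre systems of a rank-one `Ψ` are translates of `Φ₀`
  (`ConstellationCubesFibreTranslation`), so `BoundedDickson` for the ONE system `Φ₀` at scale `(B+1)N`
  controls all `(2N+1)^d` fibres: `∑_K Λ^{⊗t}(Ψ) = ∑_w β_∞(Φ_w, K_w) 𝔖(Φ_w) + o(N^{d+1})`.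
* §4 *RIGHT half*: the tree's unconditional `FibrationGlue.fibreAveraging`, glued on `K ∩ {Ψ > 0}` as in
  `FibrationGlue.restricted_of_fibreAveraging` (`restricted_fixed`, size `L = ⌈‖Ψ‖₁⌉`).
* §5 *Lift*: a same-support cube system `Ψ` on `ℤ^d` is the restriction of the rank-one system
  `Ψ'(n, m) = Ψ(n + m e₀)` on `ℤ^{d+1}` with last coefficients `aᵢ ≠ 0`; transfer back as in
  `FibrationLift.lift` (`vonMangoldtSum_padBody`, `archFactor_padBody`, `singularProduct_extendAlong`).

No new definitions. [cite: GreenTao2010, §1 (remark after Conj. 1.2); Dickson1904]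
-/

open Finset MeasureTheory

namespace Summit.Parity.GeneralizedHardyLittlewood.ConstellationCubesOneClassHLFibration

open Literature.NumberTheory.Sieve
open Summit.Parity.GeneralizedHardyLittlewood.Theorems
open Summit.Parity.GeneralizedHardyLittlewood.Theorems.FibrationFibreSums
open Summit.Parity.GeneralizedHardyLittlewood.Theorems.FibrationLift
open Summit.Parity.GeneralizedHardyLittlewood.Theorems.FibrationGlue
open Summit.Parity.GeneralizedHardyLittlewood.ConstellationCubesFibreTranslation
open Summit.Parity.GeneralizedHardyLittlewood.Theses.ConstellationCubes (OneClassHL)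
open Summit.Parity.GeneralizedHardyLittlewood.Theses.TwinMinorArcs (BoundedDickson)

variable {d t : ℕ}

/-! ### §3 LEFT half for a fixed rank-one system: `BoundedDickson` on every fibre -/

/-- **The fibre sums of a fixed rank-one system.** Assume `BoundedDickson`. For a non-degenerate
rank-one `Ψ` on `ℤ^{d+1}` with non-zero last coefficients and `ε > 0` there is `N₀` with, for all
`N ≥ N₀` and convex `K ⊆ [-N, N]^{d+1}`:
`|∑_{K ∩ ℤ^{d+1}} Λ^{⊗t}(Ψ) − ∑_{w good} β_∞(Φ_w, K_w) 𝔖(Φ_w)| ≤ ε N^{d+1}` — fibre the sum; each fibre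
system is a translate of `Φ₀` (`fibreSystem_transl`), so `BoundedDickson` for the ONE system `Φ₀` at
scale `(B+1)N`, `B = ∑|σⱼ|`, bounds all `(2N+1)^d` fibre errors by `(ε/3^d) N`.
[cite: GreenTao2010, §1 (remark after Conj. 1.2)] -/
theorem fibreSums_fixed (hBD : BoundedDickson) (ht : 1 ≤ t)
    {Ψ : Fin t → AffLinForm (d + 1)} (hΨ : IsNondegenerateSystem Ψ) (ha : ∀ i, lastCoeff (Ψ i) ≠ 0)
    {σ : Fin (d + 1) → ℤ} (hσ : ∀ i j, (Ψ i).coeff j = lastCoeff (Ψ i) * σ j) (ε : ℝ) (hε : 0 < ε) :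
    ∃ N₀ : ℕ, ∀ N : ℕ, N₀ ≤ N → ∀ K : Set (Fin (d + 1) → ℝ), Convex ℝ K → K ⊆ realBox (d + 1) N →
      |vonMangoldtSum Ψ K N -
          ∑ w ∈ goodSet Ψ N, archFactor (fibreSystem Ψ w) (fibreBody K (realPoint w)) *
            singularProduct (fibreSystem Ψ w)| ≤ ε * (N : ℝ) ^ (d + 1) := by
  -- constants
  set B : ℕ := ∑ j, (σ (Fin.castSucc j)).natAbs with hB
  set Φ₀ : Fin t → AffLinForm 1 := fibreSystem Ψ 0 with hΦ₀
  have hΦ₀nd : IsNondegenerateSystem Φ₀ := isNondegenerateSystem_fibreSystem_zero hΨ ha hσ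
  set ε₁ : ℝ := ε / 3 ^ d with hε₁
  have hε₁pos : 0 < ε₁ := by rw [hε₁]; positivity
  set ε₂ : ℝ := ε₁ / (B + 1) with hε₂
  have hε₂pos : 0 < ε₂ := by rw [hε₂]; positivity
  obtain ⟨N_D, hN_D⟩ := hBD t Φ₀ ht hΦ₀nd ε₂ hε₂pos
  refine ⟨max N_D 1, fun N hN K hK hKN => ?_⟩
  have hN1 : 1 ≤ N := le_of_max_le_right hN
  have hND : N_D ≤ N := le_of_max_le_left hN
  -- the scale of the translated fibres
  set N₁ : ℕ := (B + 1) * N with hN₁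
  have hNN₁ : N ≤ N₁ := by rw [hN₁]; nlinarith
  have hND₁ : N_D ≤ N₁ := hND.trans hNN₁
  -- abbreviations
  set Sw : (Fin d → ℤ) → ℝ := fun w => vonMangoldtSum (fibreSystem Ψ w) (fibreBody K (realPoint w)) N
    with hSw
  set Mw : (Fin d → ℤ) → ℝ := fun w =>
    archFactor (fibreSystem Ψ w) (fibreBody K (realPoint w)) * singularProduct (fibreSystem Ψ w) with hMw
  -- every fibre: translate to `Φ₀` and apply `BoundedDickson` at scale `N₁`
  have hfib : ∀ w ∈ latticeBox d N, |Sw w - Mw w| ≤ ε₁ * N := by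
    intro w hw
    have htr := fibreSystem_transl Ψ hσ w
    set c : ℤ := ∑ j, σ (Fin.castSucc j) * w j with hc
    have hcN : (N : ℤ) + |c| ≤ N₁ := by
      have := abs_shift_le σ hw
      rw [hN₁]; push_cast; nlinarith
    have hKw : fibreBody K (realPoint w) ⊆ realBox 1 N := fibreBody_subset_realBox hKN (realPoint w)
    have h1 : Sw w = vonMangoldtSum Φ₀ ((fun y => y - fun _ => (c : ℝ)) ⁻¹' fibreBody K (realPoint w)) N₁ :=
      vonMangoldtSum_transl htr hKw hcN
    have h2 : Mw w = archFactor Φ₀ ((fun y => y - fun _ => (c : ℝ)) ⁻¹' fibreBody K (realPoint w)) *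
        singularProduct Φ₀ := by
      simp only [hMw]
      rw [archFactor_transl htr, singularProduct_transl htr]
    have key := hN_D N₁ hND₁ _ (convex_transl (convex_fibreBody hK (realPoint w)) _)
      (transl_subset_realBox hKw hcN)
    rw [h1, h2]
    refine key.trans (le_of_eq ?_)
    rw [hε₂, hN₁]
    push_cast
    field_simp
  -- fibre the sum; all base points are good
  rw [vonMangoldtSum_eq_sum_fibre, goodSet_eq_latticeBox hΨ ha hσ, ← Finset.sum_sub_distrib]
  calc |∑ w ∈ latticeBox d N, (Sw w - Mw w)| ≤ ∑ w ∈ latticeBox d N, |Sw w - Mw w| :=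
        Finset.abs_sum_le_sum_abs _ _
    _ ≤ ∑ _w ∈ latticeBox d N, ε₁ * N := Finset.sum_le_sum hfib
    _ = #(latticeBox d N) * (ε₁ * N) := by rw [Finset.sum_const, nsmul_eq_mul]
    _ = (2 * N + 1) ^ d * (ε₁ * N) := by rw [card_latticeBox]; push_cast; ring
    _ ≤ (3 * N) ^ d * (ε₁ * N) := by
        refine mul_le_mul_of_nonneg_right (pow_le_pow_left₀ (by positivity) ?_ _) (by positivity)
        have : (1 : ℝ) ≤ N := by exact_mod_cast hN1
        linarith
    _ = ε * (N : ℝ) ^ (d + 1) := by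
        rw [hε₁, mul_pow, pow_succ]
        field_simp

/-! ### §4 LEFT + RIGHT: the asymptotic for a fixed rank-one system with non-zero last coefficients -/

/-- **Hardy–Littlewood for a fixed rank-one system on `ℤ^{d+1}`, `d ≥ 1`.** Assume `BoundedDickson`.
For non-degenerate rank-one `Ψ` with non-zero last coefficients: for every `ε > 0` there is `N₀` with
`|∑_{K ∩ ℤ^{d+1}} Λ^{⊗t}(Ψ) − β_∞ 𝔖(Ψ)| ≤ ε N^{d+1}` for all `N ≥ N₀` and convex `K ⊆ [-N, N]^{d+1}` —
LEFT (`fibreSums_fixed`) plus the tree's unconditional RIGHT half `FibrationGlue.fibreAveraging`, glued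
on `K⁺ = K ∩ {Ψ > 0}` exactly as in `FibrationGlue.restricted_of_fibreAveraging` (size `L = ⌈‖Ψ‖₁⌉`).
[cite: GreenTao2010, §1 (remark after Conj. 1.2)] -/
theorem restricted_fixed (hBD : BoundedDickson) (hd : 1 ≤ d) (ht : 1 ≤ t)
    {Ψ : Fin t → AffLinForm (d + 1)} (hΨ : IsNondegenerateSystem Ψ) (ha : ∀ i, lastCoeff (Ψ i) ≠ 0)
    {σ : Fin (d + 1) → ℤ} (hσ : ∀ i j, (Ψ i).coeff j = lastCoeff (Ψ i) * σ j) (ε : ℝ) (hε : 0 < ε) :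
    ∃ N₀ : ℕ, ∀ N : ℕ, N₀ ≤ N → ∀ K : Set (Fin (d + 1) → ℝ), Convex ℝ K → K ⊆ realBox (d + 1) N →
      |vonMangoldtSum Ψ K N - archFactor Ψ K * singularProduct Ψ| ≤ ε * (N : ℝ) ^ (d + 1) := by
  set L : ℕ := ⌈affLinSize Ψ 1⌉₊ with hL
  obtain ⟨N₁, hN₁⟩ := fibreSums_fixed hBD ht hΨ ha hσ (ε / 2) (half_pos hε)
  obtain ⟨N₂, hN₂⟩ := fibreAveraging d t L hd ht (ε / 2) (half_pos hε)
  refine ⟨max (max N₁ N₂) 1, fun N hN K hK hKN => ?_⟩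
  have hN1 : 1 ≤ N := le_of_max_le_right hN
  have hNN₁ : N₁ ≤ N := (le_max_left _ _).trans (le_of_max_le_left hN)
  have hNN₂ : N₂ ≤ N := (le_max_right _ _).trans (le_of_max_le_left hN)
  have hΨL : affLinSize Ψ N ≤ L :=
    (affLinSize_anti Ψ one_pos (by exact_mod_cast hN1)).trans (Nat.le_ceil _)
  -- the positive part of the body
  set K' : Set (Fin (d + 1) → ℝ) := posBody Ψ 0 K with hK'
  have hK'conv : Convex ℝ K' := convex_posBody Ψ 0 hK
  have hK'sub : K' ⊆ realBox (d + 1) N := (posBody_subset Ψ 0 K).trans hKN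
  -- LEFT on `K'`
  have hleft := hN₁ N hNN₁ K' hK'conv hK'sub
  -- RIGHT on the standing data over `K'`
  let S : FibreSetting d t :=
    { Ψ := Ψ, L := L, N := N, K := K', nondeg := hΨ, one_le_d := hd, one_le_t := ht,
      coeff_le := fun i j => natAbs_coeff_le_of_affLinSize_le hΨL i j,
      const_le := fun i => natAbs_const_le_of_affLinSize_le hN1 hΨL i,
      lastCoeff_ne := ha, one_le_N := hN1, convex := hK'conv, subset := hK'sub,
      pos := fun x hx i => realEval_gt_of_mem_posBody hx i }
  have hright :
      |∑ w ∈ goodSet Ψ N, archFactor (fibreSystem Ψ w) (fibreBody K' (realPoint w)) *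
            singularProduct (fibreSystem Ψ w) -
          (volume K').toReal * singularProduct Ψ| ≤ ε / 2 * (N : ℝ) ^ (d + 1) :=
    hN₂ S rfl hNN₂
  rw [← vonMangoldtSum_posBody_zero Ψ K N, archFactor_eq_volume_posBody Ψ K]
  calc |vonMangoldtSum Ψ K' N - (volume K').toReal * singularProduct Ψ|
      ≤ |vonMangoldtSum Ψ K' N -
            ∑ w ∈ goodSet Ψ N, archFactor (fibreSystem Ψ w) (fibreBody K' (realPoint w)) *
              singularProduct (fibreSystem Ψ w)| +
          |∑ w ∈ goodSet Ψ N, archFactor (fibreSystem Ψ w) (fibreBody K' (realPoint w)) *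
              singularProduct (fibreSystem Ψ w) -
            (volume K').toReal * singularProduct Ψ| := abs_sub_le _ _ _
    _ ≤ ε / 2 * (N : ℝ) ^ (d + 1) + ε / 2 * (N : ℝ) ^ (d + 1) := add_le_add hleft hright
    _ = ε * (N : ℝ) ^ (d + 1) := by ring

/-! ### §5 Same-support cube systems: lift along `e₀` and conclude -/

/-- **`BoundedDickson ⟹ OneClassHL`** (the fibration lemma for same-support cube systems; critic P1).
A non-degenerate cube system `Ψ` on `ℤ^d` all of whose forms have the same support is `ψᵢ = aᵢ σ·n + bᵢ`
for ONE `0/1`-vector `σ` with `σ₀ = 1` (`aᵢ = ψ̇ᵢ(e₀) ≠ 0`). Its extension `Ψ'(n, m) = Ψ(n + m e₀)` on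
`ℤ^{d+1}` is rank-one with last coefficients `aᵢ ≠ 0`, so `restricted_fixed` (fibration + the tree's
fibre averaging) gives its asymptotic from `BoundedDickson`; the padded-body transfer of
`FibrationLift.lift` (`vonMangoldtSum_padBody`, `archFactor_padBody`, `singularProduct_extendAlong`,
direction bound `1`, `N' = 2(N+1)`) brings it back to `Ψ`. With `boundedDickson_of_oneClassHL`
(hand `ConstellationCubesCubeHLGlue`) this makes item stmt-Parity-30019 equivalent BY NAME to item
stmt-Parity-13151. [cite: GreenTao2010, §1 (remark after Conj. 1.2); Dickson1904] -/
theorem oneClassHL_of_boundedDickson (hBD : BoundedDickson) : OneClassHL := by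
  intro d t hd ht Ψ hΨ hc hs ε hε
  classical
  -- the common pattern `σ = ω_{i₀}` and the dilation factors `aᵢ`
  choose a ω hω using hc
  set j₀ : Fin d := ⟨0, hd⟩ with hj₀
  set i₀ : Fin t := ⟨0, ht⟩ with hi₀
  have ha0 : ∀ i, a i ≠ 0 := fun i h => hΨ.1 i (by rw [(hω i).2, h, zero_smul])
  have hcoeff : ∀ i j, (Ψ i).coeff j = a i * ω i j := fun i j => by
    have := congr_fun (hω i).2 j
    simpa using this
  have hcoeff0 : ∀ i, (Ψ i).coeff j₀ = a i := fun i => by rw [hcoeff, (hω i).1.2 j₀ rfl, mul_one]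
  have hωeq : ∀ i j, ω i j = ω i₀ j := by
    intro i j
    have h1 := hs i i₀ j
    rw [hcoeff, hcoeff, mul_eq_zero, mul_eq_zero] at h1
    rcases (hω i).1.1 j with h | h <;> rcases (hω i₀).1.1 j with h' | h'
    · rw [h, h']
    · exact absurd (h1.mp (Or.inr h)) (not_or.mpr ⟨ha0 i₀, by rw [h']; exact one_ne_zero⟩)
    · exact absurd (h1.mpr (Or.inr h')) (not_or.mpr ⟨ha0 i, by rw [h]; exact one_ne_zero⟩)
    · rw [h, h']
  -- the direction `e₀` and the extension `Ψ'(n, m) = Ψ(n + m e₀)`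
  set g : Fin d → ℤ := Pi.single j₀ 1 with hg
  have hgt : ∀ j, (g j).natAbs ≤ 1 := fun j => by
    rw [hg, Pi.single_apply]
    split_ifs <;> simp
  have hlin : ∀ i, (Ψ i).linearPart g = a i := fun i => by
    rw [hg, AffLinForm.linearPart_single, hcoeff0]
  set Ψ' : Fin t → AffLinForm (d + 1) := fun i => (Ψ i).extendAlong (fun _ : Fin 1 => g) with hΨ'
  have hΨ'nd : IsNondegenerateSystem Ψ' := isNondegenerateSystem_extendAlong hΨ (fun _ : Fin 1 => g)
  have hlast : ∀ i, lastCoeff (Ψ' i) = a i := fun i => by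
    simp only [lastCoeff, hΨ']
    rw [extendAlong_coeff_last, hlin]
  have ha' : ∀ i, lastCoeff (Ψ' i) ≠ 0 := fun i => by rw [hlast]; exact ha0 i
  -- `Ψ'` is rank-one with `σ' = (σ, 1)`
  set σ' : Fin (d + 1) → ℤ := Fin.append (ω i₀) (fun _ : Fin 1 => 1) with hσ'
  have hσ : ∀ i j, (Ψ' i).coeff j = lastCoeff (Ψ' i) * σ' j := by
    intro i j
    rw [hlast]
    induction j using Fin.addCases with
    | left j =>
        rw [hσ', Fin.append_left]
        simp only [hΨ', AffLinForm.extendAlong_coeff_castAdd]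
        rw [hcoeff, hωeq]
    | right l =>
        rw [hσ', Fin.append_right, mul_one]
        simp only [hΨ', AffLinForm.extendAlong_coeff_natAdd]
        exact hlin i
  -- constants as in `FibrationLift.lift` with direction bound `1`
  set C : ℕ := 2 * (1 + 1) with hC
  have hCpos : (0 : ℝ) < C := by rw [hC]; positivity
  set ε' : ℝ := ε / (C : ℝ) ^ (d + 1) with hε'
  have hε'pos : 0 < ε' := div_pos hε (pow_pos hCpos _)
  obtain ⟨N₁, hN₁⟩ := restricted_fixed hBD hd ht hΨ'nd ha' hσ ε' hε'pos
  refine ⟨max N₁ 1, fun N hN K hK hKN => ?_⟩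
  have hN1 : 1 ≤ N := le_of_max_le_right hN
  have hNN₁ : N₁ ≤ N := le_of_max_le_left hN
  set N' : ℕ := (1 + 1) * (N + 1) with hN'
  set K' : Set (Fin (d + 1) → ℝ) := extBody (fun _ : Fin 1 => g) ((N : ℝ) + 1 / 2) K with hK'
  have hN'ge : N ≤ N' := by rw [hN']; nlinarith
  have hN₁N' : N₁ ≤ N' := hNN₁.trans hN'ge
  have hK'conv : Convex ℝ K' := convex_extBody (fun _ : Fin 1 => g) _ hK
  have hK'box : K' ⊆ realBox (d + 1) N' := by
    have hKN' : K ⊆ realBox d ((N : ℝ) + 1 / 2) := by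
      intro x hx
      have := hKN hx
      simp only [realBox, Set.mem_Icc, Pi.le_def] at this ⊢
      exact ⟨fun j => by linarith [this.1 j], fun j => by linarith [this.2 j]⟩
    refine extBody_subset_realBox (fun _ : Fin 1 => g) (M := 1) (fun _ j => hgt j) (by positivity) ?_ hKN'
    rw [hN']; push_cast; nlinarith
  -- `restricted_fixed` for the extension over the padded body
  have key := hN₁ N' hN₁N' K' hK'conv hK'box
  have hsum : vonMangoldtSum Ψ' K' N' = (2 * N + 1) * vonMangoldtSum Ψ K N :=
    vonMangoldtSum_padBody Ψ hgt (N' := N') (by rw [hN']; nlinarith) hKN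
  have harch : archFactor Ψ' K' = (2 * N + 1) * archFactor Ψ K := by
    rw [hK', archFactor_padBody Ψ g (by positivity) hK]; ring
  have hsing : singularProduct Ψ' = singularProduct Ψ := singularProduct_extendAlong Ψ (fun _ : Fin 1 => g)
  rw [hsum, harch, hsing] at key
  have hfac : (2 * (N : ℝ) + 1) * |vonMangoldtSum Ψ K N - archFactor Ψ K * singularProduct Ψ| ≤
      ε' * (N' : ℝ) ^ (d + 1) := by
    have h2N : (0 : ℝ) ≤ 2 * N + 1 := by positivity
    have hid : (2 * (N : ℝ) + 1) * (vonMangoldtSum Ψ K N - archFactor Ψ K * singularProduct Ψ) =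
        (2 * N + 1) * vonMangoldtSum Ψ K N - (2 * N + 1) * archFactor Ψ K * singularProduct Ψ := by
      ring
    rw [← abs_of_nonneg h2N, ← abs_mul, hid]
    exact key
  -- bookkeeping: `ε' N'^{d+1} ≤ ε N^d (2N+1)`
  have hN'le : (N' : ℝ) ≤ C * N := by
    rw [hN', hC]; push_cast
    have : (1 : ℝ) ≤ N := by exact_mod_cast hN1
    nlinarith
  have hbound : ε' * (N' : ℝ) ^ (d + 1) ≤ ε * (N : ℝ) ^ d * (2 * N + 1) := by
    calc ε' * (N' : ℝ) ^ (d + 1) ≤ ε' * ((C : ℝ) * N) ^ (d + 1) := by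
          refine mul_le_mul_of_nonneg_left ?_ hε'pos.le
          exact pow_le_pow_left₀ (by positivity) hN'le _
      _ = ε * (N : ℝ) ^ d * N := by
          rw [hε', mul_pow, pow_succ]
          field_simp
          ring
      _ ≤ ε * (N : ℝ) ^ d * (2 * N + 1) := by
          refine mul_le_mul_of_nonneg_left (by linarith [(Nat.cast_nonneg N : (0 : ℝ) ≤ N)]) ?_
          positivity
  have h2Npos : (0 : ℝ) < 2 * N + 1 := by positivity
  have := hfac.trans hbound
  rw [mul_comm] at this
  exact le_of_mul_le_mul_right this h2Npos

/-! ### §6 The converse and the equivalence BY NAME -/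

/-- **`OneClassHL ⟹ BoundedDickson`**: every non-degenerate one-variable system is a one-class cube system
(vertex `σ = (1)`, dilates `aᵢ = φ̇ᵢ(e₀) ≠ 0`), and `ε N^1 = ε N`. [folklore; cite: Dickson1904] -/
theorem boundedDickson_of_oneClassHL (h : OneClassHL) : BoundedDickson := by
  intro t Φ ht hΦ ε hε
  have hcube : ∀ i : Fin t, ∃ (a : ℤ) (ω : Fin 1 → ℤ),
      ((∀ j, ω j = 0 ∨ ω j = 1) ∧ ∀ j : Fin 1, (j : ℕ) = 0 → ω j = 1) ∧ (Φ i).coeff = a • ω := by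
    intro i
    refine ⟨(Φ i).coeff 0, fun _ => 1, ⟨fun _ => Or.inr rfl, fun _ _ => rfl⟩, ?_⟩
    funext j
    have hj : j = 0 := Fin.fin_one_eq_zero j
    subst hj
    simp
  have hsame : ∀ i i' : Fin t, ∀ j : Fin 1, (Φ i).coeff j = 0 ↔ (Φ i').coeff j = 0 := by
    intro i i' j
    have hj : j = 0 := Fin.fin_one_eq_zero j
    subst hj
    have hi : (Φ i).coeff 0 ≠ 0 := fun h0 => hΦ.1 i (by funext j; rw [Fin.fin_one_eq_zero j, h0]; rfl)
    have hi' : (Φ i').coeff 0 ≠ 0 := fun h0 => hΦ.1 i' (by funext j; rw [Fin.fin_one_eq_zero j, h0]; rfl)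
    exact ⟨fun h0 => (hi h0).elim, fun h0 => (hi' h0).elim⟩
  obtain ⟨N₀, hN₀⟩ := h 1 t le_rfl ht Φ hΦ hcube hsame ε hε
  refine ⟨N₀, fun N hN K hK hKN => ?_⟩
  simpa using hN₀ N hN K hK hKN

/-- **`OneClassHL ⟺ BoundedDickson`** (items stmt-Parity-30019 ⟺ stmt-Parity-13151 BY NAME): child 1 of the
split `CubeHL ⟺ OneClassHL ∧ RelCube` (`ConstellationCubesCubeHLGlue.node_iff`) IS bounded fixed-pattern
Dickson–Hardy–Littlewood in one variable. [cite: GreenTao2010, §1; Dickson1904] -/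
theorem oneClassHL_iff_boundedDickson : OneClassHL ↔ BoundedDickson :=
  ⟨boundedDickson_of_oneClassHL, oneClassHL_of_boundedDickson⟩

open Summit.Parity.GeneralizedHardyLittlewood.Theses in
/-- The registered stub `stub_fibration` of item stmt-Parity-30019 (BC3 skeleton line «fibration» of the
crux `OneClassHL`, route ConstellationCubes rev 2), by name and signature: fixed-system Dickson–Hardy–Littlewood
(`TwinMinorArcs.BoundedDickson`, stmt-Parity-13151) implies fibred prime `k`-tuples HL for every same-support
cube system (`ConstellationCubes.OneClassHL`). [cite: GreenTao2010, §1 (remark after Conj. 1.2)] -/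
theorem stub_fibration : TwinMinorArcs.BoundedDickson → ConstellationCubes.OneClassHL :=
  oneClassHL_of_boundedDickson

end Summit.Parity.GeneralizedHardyLittlewood.ConstellationCubesOneClassHLFibration
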